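import Mathlib
import Literature.Combinatorics.Additive.SliceRankMethod
import Literature.Combinatorics.Additive.TripleProductProperty
import Summits.MatrixMultiplication.MatrixMultiplication.Theses.SnSubsetDichotomy

/-!
Sketch for crux-ideate cards on `NoThresholdSubsetTriple` (stmt-MatrixMultiplication-8302), ideator 3.
Card A `klr-graded-codimension`: first lemma = BCCGU17 Prop. 13 over the tree's `HasSliceRankLE`,
plus the transfer C⁺ (modular slice-rank saving) → crux.
-/

namespace Summit.MatrixMultiplication.MatrixMultiplication.Cruxes.NoThresholdSubsetTriple.Sketch3

open Literature.Combinatorics.Additive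

/-- The multiplication tensor of a group over a field `K`, in the group basis:
`T_G(x,y,z) = [x*y = z]` (BCCGU17 §2, "mult" of `K[G]`). -/
noncomputable def mulTensor (K G : Type*) [Field K] [Group G] [DecidableEq G] : G → G → G → K :=
  fun x y z => if x * y = z then 1 else 0

/-- FIRST LEMMA of card A (BCCGU17, arXiv:1712.02302, Prop. 13, specialised to group algebras):
if `A, B, C` are `K`-subspaces of `K[G]` with `A·B ⊆ C` then
`slicerank_K T_G ≤ codim A + codim B + dim C`. Provable now (adapted bases + their Lemma 12). -/
theorem stub_codim (K G : Type) [Field K] [Group G] [Fintype G] [DecidableEq G]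
    (A B C : Submodule K (MonoidAlgebra K G))
    (hABC : ∀ a ∈ A, ∀ b ∈ B, a * b ∈ C) :
    HasSliceRankLE (mulTensor K G)
      ((Fintype.card G - Module.finrank K A) + (Fintype.card G - Module.finrank K B)
        + Module.finrank K C) := by
  sorry

/-- Graded form actually used: a `ℤ`-grading of `K[G]` by subspaces `V i` (direct-sum decomposition is
not even needed, only `V i · V j ⊆ W (i+j)` for the "tail" spaces) gives, for every cut `a`,
`slicerank ≤ codim V≥a + codim V≥a + dim V≥2a`.  Stated with two families of subspaces:
`Vge a = ⊕_{k ≥ a}` pieces. -/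
theorem stub_graded_cut (K G : Type) [Field K] [Group G] [Fintype G] [DecidableEq G]
    (Vge : ℤ → Submodule K (MonoidAlgebra K G))
    (hmul : ∀ i j : ℤ, ∀ a ∈ Vge i, ∀ b ∈ Vge j, a * b ∈ Vge (i + j)) (a : ℤ) :
    HasSliceRankLE (mulTensor K G)
      (2 * (Fintype.card G - Module.finrank K (Vge a)) + Module.finrank K (Vge (a + a))) := by
  sorry

/-- NAMED FACT (input from tensor geometry; Kopparty–Moshkovitz–Zuiddam 2020, geometric rank of
`⟨m,m,m⟩` is `⌈3m²/4⌉` and `GR ≤ slicerank`, combined with the Cohn–Umans coordinate restriction of a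
TPP triple): a TPP triple of three `m`-sets in `G` forces `slicerank_K T_G ≥ 3m²/4` over every field. -/
def MatMulSliceRankLower : Prop :=
  ∀ (K G : Type) [Field K] [Group G] [Fintype G] [DecidableEq G] (S T U : Finset G) (m k : ℕ),
    TripleProductProperty S T U → S.card = m → T.card = m → U.card = m →
    HasSliceRankLE (mulTensor K G) k → (3 : ℝ) / 4 * (m : ℝ) ^ 2 ≤ k

/-- TRANSFER TARGET C⁺ of card A (the modular slice-rank saving for `S_n`, BCCGU17 §6 "most ambitious
conjecture" in its weakest `e^{-c√n}` form): for some `c > 0` and all large `n` there is a field `K`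
(intended: `𝔽_p`, `p` a small prime) over which `T_{S_n}` has slice rank `≤ n!·e^{-c√n}`. -/
def ModularSliceRankSaving : Prop :=
  ∃ c : ℝ, 0 < c ∧ ∃ n₀ : ℕ, ∀ n ≥ n₀, ∃ (K : Type) (_ : Field K) (k : ℕ),
    HasSliceRankLE (mulTensor K (Equiv.Perm (Fin n))) k ∧
      (k : ℝ) ≤ (n.factorial : ℝ) * Real.exp (-(c * Real.sqrt (n : ℝ)))

/-- The transfer: C⁺ and the matrix-multiplication slice-rank fact imply the crux BY NAME
(packing `|S||T| ≤ n!` makes a threshold triple balanced: each set `> √(n!)e^{-c√n}`; shrink to a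
common size `m` by heredity of the TPP; then `3m²/4 ≤ k ≤ n!e^{-c'√n}` is absurd for `c < c'/2`). -/
theorem transfer (hGR : MatMulSliceRankLower) (hC : ModularSliceRankSaving) :
    Summit.MatrixMultiplication.MatrixMultiplication.Theses.SnSubsetDichotomy.NoThresholdSubsetTriple := by
  sorry

/-- The combinatorial heart (card A, crux K2), stated abstractly: a grading whose TAILS are small.
`GradedTailBound K n V c` says: `V` is a multiplicative `ℤ`-filtration of `K[S_n]` and some cut `a` has
`2·codim V≥a + dim V≥2a ≤ n!·e^{-c√n}`.  Card A's bet: the Brundan–Kleshchev–Wang/Hu–Mathas grading of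
`𝔽_p S_n` (dim of degree-`k` piece `= #{σ : deg_p P(σ) + deg_p Q(σ) = k}` blockwise) satisfies it. -/
def GradedTailBound (K : Type) [Field K] (n : ℕ) (c : ℝ) : Prop :=
  ∃ (Vge : ℤ → Submodule K (MonoidAlgebra K (Equiv.Perm (Fin n)))),
    (∀ i j : ℤ, ∀ a ∈ Vge i, ∀ b ∈ Vge j, a * b ∈ Vge (i + j)) ∧
    ∃ a : ℤ, (2 * ((n.factorial : ℝ) - (Module.finrank K (Vge a) : ℝ)) +
        (Module.finrank K (Vge (a + a)) : ℝ)) ≤ (n.factorial : ℝ) * Real.exp (-(c * Real.sqrt (n : ℝ)))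

/-- Glue inside the card: graded tails for all large `n` (some field each) ⇒ C⁺. -/
theorem saving_of_tails (c : ℝ) (hc : 0 < c) (n₀ : ℕ)
    (h : ∀ n ≥ n₀, ∃ (K : Type) (_ : Field K), GradedTailBound K n c) : ModularSliceRankSaving := by
  sorry

/-- Polynomial rung of the same line (card A, moment ladder R2): slice rank of `T_{S_n}` over some field
is `≤ n!·n^{-C}` for every `C`, eventually. -/
def ModularSliceRankPolySaving : Prop :=
  ∀ C : ℝ, ∃ n₀ : ℕ, ∀ n ≥ n₀, ∃ (K : Type) (_ : Field K) (k : ℕ),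
    HasSliceRankLE (mulTensor K (Equiv.Perm (Fin n))) k ∧
      (k : ℝ) * (n : ℝ) ^ C ≤ (n.factorial : ℝ)

/-- R2 transfer: the polynomial rung proves the route's rank-5 crux `PolynomialSlack` BY NAME
(same bookkeeping as `transfer`: packing, heredity, `m² ≤ (4/3)·slicerank`). -/
theorem transfer_poly (hGR : MatMulSliceRankLower) (hP : ModularSliceRankPolySaving) :
    Summit.MatrixMultiplication.MatrixMultiplication.Theses.SnSubsetDichotomy.PolynomialSlack := by
  sorry

end Summit.MatrixMultiplication.MatrixMultiplication.Cruxes.NoThresholdSubsetTriple.Sketch3
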